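import Mathlib
import Summits.CriticalPhenomena.PercolationContinuityZ3.Theorems.PercNearOneGluingNoHeavyLowerTailMSSharpCloseFamily
import HarnessLib
import HarnessLib.Audit

/-!
# The hemisphere transversal of the debtor pairs and the reduction 'Hemisphere-MS ⟹ K♯' (hp-7 gen 85)

Support file for crux `stmt-CriticalPhenomena-4575` (`NoHeavyLowerTail`, route `PercNearOneGluingNoHeavy`), hull-port seat `prim-hp-7`
(generation 85); `--supports stmt-CriticalPhenomena-4575`.  No `sorry`.
Memo `run/shared/lean/prim/prim-hp-7/FROM-prim-hp-7-g85-HEMISPHERE.md`.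

**Setting** (`GeneratedDonors`): monotone labellings `g h : Finset α → Lab 3`; a debtor set `q` is CHARGED THROUGH the ordered petal pair
`(x, y)` (`x ≠ y`) if `q ∈ Z_x` and `qᶜ ∈ Z_y`, i.e. the hexagon vertex `(x,y)` lies below `c q` and its antipode `(y,x)` below `c qᶜ`
(`Thru`).  Fix a linear order `a < b < c` of the three petals (a transitive orientation of `K₃` = three consecutive hexagon vertices =
a HEMISPHERE).  The hemisphere family `hemisphere g h a b c` consists of the debtors charged through a forward pair `(a,b)`, `(a,c)` or
`(b,c)`, except the sets labelled `(g,h)(q) = (A,B)`, `(g,h)(qᶜ) = (C_b,C_b)` (whose complements are also forward).  It is a TRANSVERSAL of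
the debtor pairs: every debtor `q` has `q` or `qᶜ` in it (`mem_hemisphere_or_compl_mem`).

* `genOf g h H` — the close differences `q \ s` (`q, s ∈ H`, `qᶜ` linked to `s`) of a family `H`; for `H ⊆ debtors` it lies in `genSharp`.
* `HemisphereMS` — **Hemisphere conjecture** (gen 85): for all monotone `g, h` SOME hemisphere family `H` satisfies the Marica–Schönheim-type
  bound `#H ≤ #(genOf g h H)`.  Evidence (memo §2): exhaustive over all 30 046 920 monotone maps `2^[4] → 𝓗` — at least two of the three
  hemisphere classes always pass, and the hemisphere whose middle petal pair `{a,c}` carries the most charged sets ('heaviest middle axis')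
  NEVER fails (0 / 14 695 848 eligible cases); 0 failures of that rule on 3 572 random maps `n ≤ 7` and on all 2 761 gen-84 hard instances
  `n = 5,6,7`; kit census j313470/j313503.  An obligation of this programme, never used as a fact.
* `kSharp_of_hemisphereMS` — **Hemisphere-MS ⟹ K♯**: `#debtors ≤ 2 #H ≤ 2 #(genOf H) ≤ 2 #genSharp` and `kSharp_ineq_of_msSharp_ineq`
  (so Hemisphere-MS ⟹ MS♯-inequality ⟹ K♯ ⟹ K, FS′, FS).
-/

namespace Summit.CriticalPhenomena.PercolationContinuityZ3.Theorems

namespace GeneratedDonors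

open Finset FinsetFamily OrientedAntipodalHall AntipodalStrongHarris AntipodalStrongHarris.Lab

section Defs

variable {α : Type*} [Fintype α] [DecidableEq α]

/-- `q` is charged THROUGH the ordered petal pair `(x, y)`: the hexagon vertex `(x,y)` lies below `c q` and `(y,x)` below `c qᶜ`
(`q ∈ Z_x`, `qᶜ ∈ Z_y`). -/
def Thru (g h : Finset α → Lab 3) (x y : Fin 3) (q : Finset α) : Prop :=
  InSupp (g q) (h (univ \ q)) x y ∧ InSupp (g (univ \ q)) (h q) y x

/-- `Thru` is decidable. -/
instance (g h : Finset α → Lab 3) (x y : Fin 3) (q : Finset α) : Decidable (Thru g h x y q) := by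
  unfold Thru; infer_instance

/-- The EXCEPTIONAL type for the petal order with middle petal `b`: `(g,h)(q) = (A,B)` and `(g,h)(qᶜ) = (C_b, C_b)` (both `q` and `qᶜ`
are forward-charged; the hemisphere keeps only `qᶜ`). -/
def Exceptional (g h : Finset α → Lab 3) (b : Fin 3) (q : Finset α) : Prop :=
  g q = top ∧ h q = bot ∧ g (univ \ q) = petal b ∧ h (univ \ q) = petal b

/-- `Exceptional` is decidable. -/
instance (g h : Finset α → Lab 3) (b : Fin 3) (q : Finset α) : Decidable (Exceptional g h b q) := by
  unfold Exceptional; infer_instance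

/-- The HEMISPHERE family of the petal order `a < b < c`: debtors charged through a forward pair `(a,b)`, `(a,c)` or `(b,c)`, minus
the exceptional type. -/
def hemisphere (g h : Finset α → Lab 3) (a b c : Fin 3) : Finset (Finset α) :=
  {q ∈ debtors g h | (Thru g h a b q ∨ Thru g h a c q ∨ Thru g h b c q) ∧ ¬ Exceptional g h b q}

/-- The close differences of a family `H`: `{q \ s : q, s ∈ H, qᶜ linked to s}`. -/
def genOf (g h : Finset α → Lab 3) (H : Finset (Finset α)) : Finset (Finset α) :=
  ((H ×ˢ H).filter fun p => Linked g h (univ \ p.1) p.2).image fun p => p.1 \ p.2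

end Defs

/-- **Hemisphere conjecture** (hp-7 gen 85): for all monotone `g, h` some hemisphere family is at most its own family of close
differences.  An obligation, not a fact (exhaustive on `2^[4]`; memo FROM-prim-hp-7-g85-HEMISPHERE.md). -/
def HemisphereMS : Prop :=
  ∀ (α : Type) [Fintype α] [DecidableEq α] (g h : Finset α → Lab 3),
    (∀ ⦃X Y : Finset α⦄, X ⊆ Y → g X ≤ g Y) → (∀ ⦃X Y : Finset α⦄, X ⊆ Y → h X ≤ h Y) →
      ∃ a b c : Fin 3, a ≠ b ∧ b ≠ c ∧ a ≠ c ∧ #(hemisphere g h a b c) ≤ #(genOf g h (hemisphere g h a b c))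

/-- **HEMISPHERE CONJECTURE** as a typed obligation. [this work; obligation] -/
@[conjecture] def ConjectureHemisphereMS : Prop := HemisphereMS

section Transversal

variable {α : Type} [Fintype α] [DecidableEq α]

/-- Double complement inside `univ`. -/
theorem sdiff_sdiff_univ (q : Finset α) : (univ : Finset α) \ (univ \ q) = q := by
  rw [Finset.sdiff_sdiff_eq_self (subset_univ q)]

/-- Charged through `(x,y)` at `q` iff charged through `(y,x)` at `qᶜ`. -/
theorem thru_compl_iff (g h : Finset α → Lab 3) (x y : Fin 3) (q : Finset α) :
    Thru g h y x (univ \ q) ↔ Thru g h x y q := by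
  unfold Thru; rw [sdiff_sdiff_univ]; exact And.comm

/-- A charged set is charged through some ordered petal pair. -/
theorem exists_thru_of_isCharged {g h : Finset α → Lab 3} {q : Finset α} (hq : IsCharged 3 g h q) :
    ∃ x y : Fin 3, x ≠ y ∧ Thru g h x y q := by
  obtain ⟨x, y, hxy, h1, h2, h3, h4⟩ := hq
  exact ⟨x, y, hxy, ⟨hxy, h1, h4⟩, ⟨hxy.symm, h3, h2⟩⟩

/-- Charged sets have charged complements. -/
theorem isCharged_compl {g h : Finset α → Lab 3} {q : Finset α} (hq : IsCharged 3 g h q) : IsCharged 3 g h (univ \ q) := by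
  obtain ⟨x, y, hxy, h1, h2, h3, h4⟩ := hq
  exact ⟨y, x, hxy.symm, h3, h4, by rw [sdiff_sdiff_univ]; exact h1, by rw [sdiff_sdiff_univ]; exact h2⟩

/-- Credited sets have credited complements. -/
theorem credited_compl {g h : Finset α → Lab 3} {q : Finset α} (hq : Credited g h q) : Credited g h (univ \ q) := by
  rcases hq with ⟨h1, h2⟩ | ⟨h1, h2⟩
  · exact Or.inr ⟨by rw [sdiff_sdiff_univ]; exact h1, h2⟩
  · exact Or.inl ⟨h1, by rw [sdiff_sdiff_univ]; exact h2⟩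

/-- The debtor family is closed under complements. -/
theorem compl_mem_debtors {g h : Finset α → Lab 3} {q : Finset α} (hq : q ∈ debtors g h) : univ \ q ∈ debtors g h := by
  unfold debtors at hq ⊢
  rw [mem_filter] at hq ⊢
  refine ⟨mem_univ _, isCharged_compl hq.2.1, fun hc => hq.2.2 ?_⟩
  have := credited_compl hc; rwa [sdiff_sdiff_univ] at this

/-- Membership in the hemisphere family. -/
theorem mem_hemisphere {g h : Finset α → Lab 3} {a b c : Fin 3} {q : Finset α} :
    q ∈ hemisphere g h a b c ↔ q ∈ debtors g h ∧ (Thru g h a b q ∨ Thru g h a c q ∨ Thru g h b c q) ∧ ¬ Exceptional g h b q := by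
  unfold hemisphere; rw [mem_filter]

/-- The hemisphere family consists of debtors. -/
theorem hemisphere_subset_debtors (g h : Finset α → Lab 3) (a b c : Fin 3) : hemisphere g h a b c ⊆ debtors g h :=
  fun _ hq => (mem_hemisphere.mp hq).1

/-- **The hemisphere family is a transversal of the debtor pairs**: for a linear order `a < b < c` of the three petals, every debtor `q`
has `q` or `qᶜ` in `hemisphere g h a b c`.  (A backward pair at `q` is a forward pair at `qᶜ`; the exceptional type's complement is
forward through `(b,c)` and not exceptional.) -/
theorem mem_hemisphere_or_compl_mem (g h : Finset α → Lab 3) {a b c : Fin 3} (hab : a ≠ b) (hbc : b ≠ c) (hac : a ≠ c)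
    {q : Finset α} (hq : q ∈ debtors g h) : q ∈ hemisphere g h a b c ∨ univ \ q ∈ hemisphere g h a b c := by
  have hqc := compl_mem_debtors hq
  have hch : IsCharged 3 g h q := by
    unfold debtors at hq; exact (mem_filter.mp hq).2.1
  -- every element of `Fin 3` is `a`, `b` or `c`
  have habc : ∀ z : Fin 3, z = a ∨ z = b ∨ z = c := by
    intro z
    have : ∀ (a b c z : Fin 3), a ≠ b → b ≠ c → a ≠ c → (z = a ∨ z = b ∨ z = c) := by decide
    exact this a b c z hab hbc hac
  -- forwardness of `q` or of `qᶜ`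
  have hfwd : (Thru g h a b q ∨ Thru g h a c q ∨ Thru g h b c q) ∨
      (Thru g h a b (univ \ q) ∨ Thru g h a c (univ \ q) ∨ Thru g h b c (univ \ q)) := by
    obtain ⟨x, y, hxy, ht⟩ := exists_thru_of_isCharged hch
    have htc : Thru g h y x (univ \ q) := (thru_compl_iff g h x y q).mpr ht
    rcases habc x with rfl | rfl | rfl <;> rcases habc y with rfl | rfl | rfl
    · exact absurd rfl hxy
    · exact Or.inl (Or.inl ht)
    · exact Or.inl (Or.inr (Or.inl ht))
    · exact Or.inr (Or.inl htc)
    · exact absurd rfl hxy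
    · exact Or.inl (Or.inr (Or.inr ht))
    · exact Or.inr (Or.inr (Or.inl htc))
    · exact Or.inr (Or.inr (Or.inr htc))
    · exact absurd rfl hxy
  -- the exceptional type: its complement is forward through `(b, c)` and not exceptional
  have hexc : ∀ r : Finset α, r ∈ debtors g h → univ \ r ∈ debtors g h → Exceptional g h b r →
      univ \ r ∈ hemisphere g h a b c := by
    intro r _ hrc ⟨h1, h2, h3, h4⟩
    refine mem_hemisphere.mpr ⟨hrc, Or.inr (Or.inr ⟨⟨hbc, Or.inl h3, ?_⟩, ⟨hbc.symm, ?_, Or.inr h4⟩⟩), ?_⟩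
    · rw [sdiff_sdiff_univ]; exact Or.inl h2
    · rw [sdiff_sdiff_univ]; exact Or.inr h1
    · rintro ⟨h5, -, -, -⟩; rw [h3] at h5; cases h5
  by_cases hE : Exceptional g h b q
  · exact Or.inr (hexc q hq hqc hE)
  by_cases hEc : Exceptional g h b (univ \ q)
  · have := hexc (univ \ q) hqc (by rw [sdiff_sdiff_univ]; exact hq) hEc
    rw [sdiff_sdiff_univ] at this; exact Or.inl this
  rcases hfwd with hf | hf
  · exact Or.inl (mem_hemisphere.mpr ⟨hq, hf, hE⟩)
  · exact Or.inr (mem_hemisphere.mpr ⟨hqc, hf, hEc⟩)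

/-- Hence the debtors are at most twice the hemisphere family. -/
theorem card_debtors_le_two_mul_card_hemisphere (g h : Finset α → Lab 3) {a b c : Fin 3}
    (hab : a ≠ b) (hbc : b ≠ c) (hac : a ≠ c) : #(debtors g h) ≤ 2 * #(hemisphere g h a b c) :=
  card_debtors_le_two_mul_of_transversal g h _ fun _ hq => mem_hemisphere_or_compl_mem g h hab hbc hac hq

end Transversal

section Reduction

variable {α : Type} [Fintype α] [DecidableEq α]

/-- Membership in `genOf`. -/
theorem mem_genOf {g h : Finset α → Lab 3} {H : Finset (Finset α)} {d : Finset α} :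
    d ∈ genOf g h H ↔ ∃ q ∈ H, ∃ s ∈ H, Linked g h (univ \ q) s ∧ q \ s = d := by
  unfold genOf
  constructor
  · intro hd
    obtain ⟨p, hp, rfl⟩ := mem_image.mp hd
    rw [mem_filter, mem_product] at hp
    exact ⟨p.1, hp.1.1, p.2, hp.1.2, hp.2, rfl⟩
  · rintro ⟨q, hq, s, hs, hl, rfl⟩
    exact mem_image.mpr ⟨(q, s), by rw [mem_filter, mem_product]; exact ⟨⟨hq, hs⟩, hl⟩, rfl⟩

/-- The close differences of a family of debtors are generated differences: `genOf g h H ⊆ genSharp g h`. -/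
theorem genOf_subset_genSharp (g h : Finset α → Lab 3) {H : Finset (Finset α)} (hH : H ⊆ debtors g h) :
    genOf g h H ⊆ genSharp g h := by
  intro d hd
  obtain ⟨q, hq, s, hs, hl, rfl⟩ := mem_genOf.mp hd
  exact mem_genSharp.mpr ⟨q, hH hq, s, hH hs, hl, rfl⟩

/-- **A hemisphere certificate gives the K♯ inequality**: if some hemisphere family `H` (for a linear order of the petals) satisfies
`#H ≤ #(genOf g h H)`, then `#charged ≤ #credited` at `(g, h)`. -/
theorem kSharp_ineq_of_hemisphere (g h : Finset α → Lab 3)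
    (hg : ∀ ⦃X Y : Finset α⦄, X ⊆ Y → g X ≤ g Y) (hh : ∀ ⦃X Y : Finset α⦄, X ⊆ Y → h X ≤ h Y)
    {a b c : Fin 3} (hab : a ≠ b) (hbc : b ≠ c) (hac : a ≠ c)
    (hH : #(hemisphere g h a b c) ≤ #(genOf g h (hemisphere g h a b c))) :
    #{q ∈ (univ : Finset (Finset α)) | IsCharged 3 g h q} ≤
      #{q ∈ (univ : Finset (Finset α)) | (g q = top ∧ h (univ \ q) = bot) ∨ (g (univ \ q) = top ∧ h q = bot)} := by
  refine kSharp_ineq_of_msSharp_ineq g h hg hh ?_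
  calc #(debtors g h) ≤ 2 * #(hemisphere g h a b c) := card_debtors_le_two_mul_card_hemisphere g h hab hbc hac
    _ ≤ 2 * #(genOf g h (hemisphere g h a b c)) := Nat.mul_le_mul_left 2 hH
    _ ≤ 2 * #(genSharp g h) :=
        Nat.mul_le_mul_left 2 (card_le_card (genOf_subset_genSharp g h (hemisphere_subset_debtors g h a b c)))

/-- **Hemisphere conjecture ⟹ Conjecture K♯** (`KSharp 3`, hence `ConjectureKSharp`, Conjecture K, FS′, FS). -/
theorem kSharp_of_hemisphereMS (hHem : HemisphereMS) : KSharp 3 := by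
  intro α _ _ g h hg hh
  obtain ⟨a, b, c, hab, hbc, hac, hH⟩ := hHem α g h hg hh
  exact kSharp_ineq_of_hemisphere g h hg hh hab hbc hac hH

/-- The same on the typed obligations. -/
theorem conjectureKSharp_of_conjectureHemisphereMS (hHem : ConjectureHemisphereMS) : ConjectureKSharp :=
  kSharp_of_hemisphereMS hHem

end Reduction

end GeneratedDonors

end Summit.CriticalPhenomena.PercolationContinuityZ3.Theorems
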